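import Literature.Algebra.EuclideanLattices.PeriodizeComplex
import HarnessLib

/-!
# Uniform bounds for the derivatives of a periodized bump

Topic `Literature/Algebra/EuclideanLattices`, continuing `PeriodizeComplex`. The periodization of a
smooth bump `g` supported in the ball of radius `R` is, near every point, a FINITE sum of
translates `g(· + ℓ)`; by periodicity it suffices to look at points of the fundamental
parallelepiped. Hence the iterated derivatives of `periodizeC L g` are bounded by an OVERLAP
CONSTANT (a number of lattice points, depending only on `L` and `R`) times the bounds for `g`
— the input of the coefficient decay `norm_coeff_periodizeC_le` (Hecke 1920 §1, Mitsui 1956 §3):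

* `fdomRadius L` — a radius of a ball containing `fdom L`; `overlapCard L R`;
* `periodizeC_eq_sum` — the local finite-sum formula;
* `iteratedFDeriv_periodizeC_eq_sum` — `D^m (periodizeC g)(x) = ∑_{ℓ ∈ ballPts} D^m g (x + ℓ)`;
* `iteratedFDeriv_periodizeC_add_of_mem` — periodicity of the derivatives;
* **`norm_iteratedFDeriv_periodizeC_le`** — `‖D^m (periodizeC g)(x)‖ ≤ overlapCard L R · sup ‖D^m g‖`
  for ALL `x`.

## References

* E. Hecke, Math. Z. 6 (1920), §1. [cite: HeckeMathZ1920, §1]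
* L. Grafakos, *Classical Fourier Analysis* (2014), §3.1. [folklore]
-/

noncomputable section

open MeasureTheory Module Submodule Filter Topology Complex Finset ZSpan
open scoped Real

namespace Literature.Algebra.EuclideanLattices.LatticePeriodic

variable {E : Type*} [NormedAddCommGroup E] [NormedSpace ℝ E] [FiniteDimensional ℝ E]
variable (L : Submodule ℤ E) [DiscreteTopology L] [IsZLattice ℝ L]

/-! ## Constants -/

/-- A radius `R_D ≥ 0` with `fdom L ⊆ closedBall 0 R_D`. [folklore] -/
def fdomRadius : ℝ := max 0 (Classical.choose (Metric.isBounded_iff_subset_closedBall (c := (0 : E)) |>.1 (fdom_isBounded L)))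

/-- `fdom L` lies in the ball of radius `fdomRadius L`. [folklore] -/
theorem norm_le_fdomRadius {x : E} (hx : x ∈ fdom L) : ‖x‖ ≤ fdomRadius L := by
  have h := Classical.choose_spec (Metric.isBounded_iff_subset_closedBall (c := (0 : E)) |>.1 (fdom_isBounded L))
  have := h hx
  rw [Metric.mem_closedBall, dist_zero_right] at this
  exact this.trans (le_max_right _ _)

/-- `0 ≤ fdomRadius L`. [folklore] -/
theorem fdomRadius_nonneg : 0 ≤ fdomRadius L := le_max_left _ _

/-- **The overlap constant** `N(L, R) = #{ℓ ∈ L : ‖ℓ‖ ≤ R + R_D + 1}`. [folklore] -/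
def overlapCard (R : ℝ) : ℕ := (ballPts (L := L) (R + (fdomRadius L + 1))).card

variable {L}

/-! ## The local finite-sum formula and the derivatives -/

/-- `periodizeC L g x = ∑_{ℓ ∈ ballPts (R + R')} g (x + ℓ)` for `‖x‖ ≤ R'`. [folklore] -/
theorem periodizeC_eq_sum {g : E → ℂ} {R : ℝ} (hg : ∀ y, R < ‖y‖ → g y = 0) {R' : ℝ} {x : E} (hx : ‖x‖ ≤ R') :
    periodizeC L g x = ∑ ℓ ∈ ballPts (L := L) (R + R'), g (x + ℓ) := by
  obtain ⟨hre, him⟩ := re_im_support hg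
  unfold periodizeC
  rw [periodize_eq_sum hre hx, periodize_eq_sum him hx, Complex.ofReal_sum, Complex.ofReal_sum, Finset.sum_mul,
    ← Finset.sum_add_distrib]
  exact Finset.sum_congr rfl fun ℓ _ => Complex.re_add_im _

/-- **`D^m (periodizeC g)(x₀) = ∑_{ℓ ∈ ballPts (R + ‖x₀‖ + 1)} D^m g (x₀ + ℓ)`** for smooth `g`
supported in the ball of radius `R`. [folklore] -/
theorem iteratedFDeriv_periodizeC_eq_sum {g : E → ℂ} (hc : ContDiff ℝ (⊤ : ℕ∞) g) {R : ℝ} (hg : ∀ y, R < ‖y‖ → g y = 0)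
    (m : ℕ) (x₀ : E) :
    iteratedFDeriv ℝ m (periodizeC L g) x₀ =
      ∑ ℓ ∈ ballPts (L := L) (R + (‖x₀‖ + 1)), iteratedFDeriv ℝ m g (x₀ + ℓ) := by
  -- locally `periodizeC g` is the finite sum
  have hloc : periodizeC L g =ᶠ[𝓝 x₀] fun x => ∑ ℓ ∈ ballPts (L := L) (R + (‖x₀‖ + 1)), g (x + ℓ) := by
    refine Filter.eventuallyEq_of_mem (Metric.ball_mem_nhds x₀ one_pos) fun x hx => ?_
    refine periodizeC_eq_sum hg ?_
    rw [Metric.mem_ball, dist_eq_norm] at hx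
    have := norm_sub_norm_le x x₀
    linarith
  rw [(hloc.iteratedFDeriv (𝕜 := ℝ) m).eq_of_nhds]
  have hsum : (fun x => ∑ ℓ ∈ ballPts (L := L) (R + (‖x₀‖ + 1)), g (x + ℓ)) =
      ∑ ℓ ∈ ballPts (L := L) (R + (‖x₀‖ + 1)), fun x => g (x + ℓ) := by
    funext x; simp [Finset.sum_apply]
  have hcd : ∀ ℓ ∈ ballPts (L := L) (R + (‖x₀‖ + 1)), ContDiffAt ℝ (m : ℕ∞) (fun x => g (x + (ℓ : E))) x₀ := by
    intro ℓ _
    have h1 : ContDiff ℝ (⊤ : ℕ∞) fun x => g (x + (ℓ : E)) := hc.comp (contDiff_id.add contDiff_const)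
    exact (h1.of_le (by exact_mod_cast le_top)).contDiffAt
  rw [hsum, iteratedFDeriv_sum_apply hcd]
  refine Finset.sum_congr rfl fun ℓ _ => ?_
  exact iteratedFDeriv_comp_add_right m (ℓ : E) x₀

omit [FiniteDimensional ℝ E] [DiscreteTopology L] [IsZLattice ℝ L] in
/-- The derivatives of the periodization are periodic. [folklore] -/
theorem iteratedFDeriv_periodizeC_add_of_mem (g : E → ℂ) {ℓ₀ : E} (hℓ₀ : ℓ₀ ∈ L) (m : ℕ) (x : E) :
    iteratedFDeriv ℝ m (periodizeC L g) (x + ℓ₀) = iteratedFDeriv ℝ m (periodizeC L g) x := by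
  have hper : (fun z => periodizeC L g (z + ℓ₀)) = periodizeC L g := funext fun z => periodizeC_add_of_mem g hℓ₀ z
  rw [← iteratedFDeriv_comp_add_right m ℓ₀ x, hper]

/-- **Uniform bound**: `‖D^m (periodizeC g)(x)‖ ≤ N(L, R) · D` for all `x`, whenever
`‖D^m g‖ ≤ D` everywhere (`D ≥ 0`). [cite: HeckeMathZ1920, §1] -/
theorem norm_iteratedFDeriv_periodizeC_le {g : E → ℂ} (hc : ContDiff ℝ (⊤ : ℕ∞) g) {R : ℝ} (hg : ∀ y, R < ‖y‖ → g y = 0)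
    (m : ℕ) {D : ℝ} (hD0 : 0 ≤ D) (hD : ∀ y, ‖iteratedFDeriv ℝ m g y‖ ≤ D) (x : E) :
    ‖iteratedFDeriv ℝ m (periodizeC L g) x‖ ≤ overlapCard L R * D := by
  -- reduce to the fundamental domain
  set x' : E := ZSpan.fract (rBasis L) x with hx'
  have hx'mem : x' ∈ fdom L := ZSpan.fract_mem_fundamentalDomain (rBasis L) x
  have hdiff : x - x' ∈ L := by
    rw [hx', ZSpan.fract_apply, sub_sub_cancel]
    have h : ((ZSpan.floor (rBasis L) x : span ℤ (Set.range (rBasis L))) : E) ∈ span ℤ (Set.range (rBasis L)) :=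
      (ZSpan.floor (rBasis L) x).2
    exact SetLike.le_def.1 (le_of_eq (rBasis_span L)) h
  have hx_eq : x = x' + (x - x') := by abel
  rw [hx_eq, iteratedFDeriv_periodizeC_add_of_mem g hdiff, iteratedFDeriv_periodizeC_eq_sum hc hg m x']
  -- the finite sum has at most `overlapCard` terms, each of norm `≤ D`
  have hR' : ‖x'‖ + 1 ≤ fdomRadius L + 1 := by linarith [norm_le_fdomRadius L hx'mem]
  have hsub : ballPts (L := L) (R + (‖x'‖ + 1)) ⊆ ballPts (L := L) (R + (fdomRadius L + 1)) := by
    intro ℓ hℓ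
    rw [mem_ballPts] at hℓ ⊢
    linarith
  calc ‖∑ ℓ ∈ ballPts (L := L) (R + (‖x'‖ + 1)), iteratedFDeriv ℝ m g (x' + ℓ)‖
      ≤ ∑ ℓ ∈ ballPts (L := L) (R + (‖x'‖ + 1)), ‖iteratedFDeriv ℝ m g (x' + ℓ)‖ := norm_sum_le _ _
    _ ≤ ∑ _ℓ ∈ ballPts (L := L) (R + (‖x'‖ + 1)), D := Finset.sum_le_sum fun ℓ _ => hD _
    _ ≤ ∑ _ℓ ∈ ballPts (L := L) (R + (fdomRadius L + 1)), D := Finset.sum_le_sum_of_subset_of_nonneg hsub fun _ _ _ => hD0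
    _ = overlapCard L R * D := by rw [Finset.sum_const, nsmul_eq_mul]; rfl

/-- **Uniform bound for the values** (`m = 0`): `‖periodizeC g (x)‖ ≤ N(L, R) · sup ‖g‖`. [folklore] -/
theorem norm_periodizeC_le {g : E → ℂ} (hc : ContDiff ℝ (⊤ : ℕ∞) g) {R : ℝ} (hg : ∀ y, R < ‖y‖ → g y = 0)
    {D : ℝ} (hD0 : 0 ≤ D) (hD : ∀ y, ‖g y‖ ≤ D) (x : E) :
    ‖periodizeC L g x‖ ≤ overlapCard L R * D := by
  have h := norm_iteratedFDeriv_periodizeC_le (L := L) hc hg 0 hD0 (fun y => by rw [norm_iteratedFDeriv_zero]; exact hD y) x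
  rwa [norm_iteratedFDeriv_zero] at h

end Literature.Algebra.EuclideanLattices.LatticePeriodic
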